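import Literature.Geometry.Riemannian.CurvatureDerivativeNormSq
import Literature.Geometry.Lorentzian.CoordEntropyFormula
import HarnessLib

/-!
# Global curvature derivative estimates along a Ricci flow (Topping 2006, Thm. 3.3.1 / Shi)
(topic `Geometry/Riemannian`)

This file PROVES the qualitative content of **Topping 2006, Thm. 3.3.1 / Cor. 3.3.2 (`j = 0`)**
(Bernstein–Shi global derivative estimates; Hamilton 1982, §13) in the form used by the proof of
the curvature blow-up theorem (Thm. 5.3.1, pp. 46–47): along a Ricci flow of Riemannian metrics on
`[0, T)` on a closed manifold whose curvature is bounded in frames (`CurvatureBoundedBy … K` at all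
times), **every `U_k = |∇^k Rm|²` is bounded on `M × [δ, T)` for every `δ ∈ (0, T)`**
(`IsRicciFlow.curvDerivNormSq_le_of_curvatureBoundedBy`), following the printed proof (p. 38):
with bounds on `U_0, …, U_k` in hand, the function `W = t U_{k+1} + α U_k` satisfies
`∂_t W ≤ Δ W + C` for `α` large (the evolution inequalities (3.3.4) for `U_{k+1}` and `U_k`,
`IsRicciFlow.derivWithin_curvDerivNormSq_le`, the good term `−2α U_{k+1}` of the latter absorbing
the bad terms of the former), so the weak maximum principle (Thm. 3.1.1, `weakMaximumPrinciple`)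
bounds `W`, hence `t U_{k+1}` (`IsRicciFlow.mul_curvDerivNormSq_succ_le`); induction on `k` with a
time translation at each step.

## References

* P. Topping, *Lectures on the Ricci flow*, LMS Lecture Note Series 325, CUP 2006, Thm. 3.1.1
  (p. 35), §3.3: Thm. 3.3.1 and its proof, Cor. 3.3.2 (pp. 37–39), §5.3 (pp. 46–47). [Topping2006]
* R. S. Hamilton, *Three-manifolds with positive Ricci curvature*, J. Differential Geom. 17
  (1982), §13 (Thm. 13.4 ff.). [Hamilton1982]
-/

noncomputable section

set_option maxSynthPendingDepth 3

open Bundle Set Filter Module Function TopologicalSpace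
open scoped Manifold ContDiff Topology

namespace Literature.Geometry.Riemannian

open Lorentzian Lorentzian.PseudoRiemannianMetric MetricCoord

section Linear

variable {E : Type*} [NormedAddCommGroup E] [NormedSpace ℝ E] [FiniteDimensional ℝ E]
  [CompleteSpace E] {H : Type*} [TopologicalSpace H] {I : ModelWithCorners ℝ E H} [I.Boundaryless]
  {M : Type*} [TopologicalSpace M] [ChartedSpace H M] [IsManifold I ∞ M]

omit [FiniteDimensional ℝ E] [CompleteSpace E] in
/-- The chart representative `f ∘ (extChartAt I z)⁻¹` of a function `C²` at `z` is `C²` at the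
chart image of `z`. [folklore] -/
theorem contDiffAt_comp_extChartAt_symm_self {f : M → ℝ} {z : M} (hf : CMDiffAt 2 f z) :
    ContDiffAt ℝ 2 (f ∘ (extChartAt I z).symm) (extChartAt I z z) := by
  have hsymm : ContMDiffAt 𝓘(ℝ, E) I 2 (extChartAt I z).symm (extChartAt I z z) :=
    ((contMDiffOn_extChartAt_symm (n := ∞) z).of_le (WithTop.coe_le_coe.mpr le_top)).contMDiffAt
      ((isOpen_extChartAt_target z).mem_nhds (mem_extChartAt_target z))
  have hf' : CMDiffAt 2 f ((extChartAt I z).symm (extChartAt I z z)) := by rwa [extChartAt_to_inv]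
  exact contMDiffAt_iff_contDiffAt.mp (hf'.comp _ hsymm)

/-- **Linearity of the Laplace–Beltrami operator on `C²` functions**:
`Δ_g (a f₁ + c f₂) = a Δ_g f₁ + c Δ_g f₂` at every point where `f₁, f₂` are `C²` (read in the
chart at the point, `dalembertian_comap` / `dalembertian_eq_lapAt`, where it is
`lapAt_add` / `lapAt_const_mul`). [folklore] -/
theorem laplaceBeltrami_add_mul (g : PseudoRiemannianMetric I ∞ E (TangentSpace I : M → Type _))
    {f₁ f₂ : M → ℝ} {z : M} (hf₁ : CMDiffAt 2 f₁ z) (hf₂ : CMDiffAt 2 f₂ z) (a c : ℝ) :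
    g.laplaceBeltrami (fun y ↦ a * f₁ y + c * f₂ y) z =
      a * g.laplaceBeltrami f₁ z + c * g.laplaceBeltrami f₂ z := by
  haveI := g.hasLeviCivita
  haveI := (chartPullback I g z).hasLeviCivita
  have hG := val_chartPullback_eq_chartRep (fun _ ↦ g) z 0
  set u₀ : chartTarget I z := ⟨extChartAt I z z, mem_extChartAt_target z⟩ with hu₀
  have hzu : chartInv I z u₀ = z := extChartAt_to_inv z
  have hΦ₁ := contDiffAt_comp_extChartAt_symm_self hf₁
  have hΦ₂ := contDiffAt_comp_extChartAt_symm_self hf₂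
  have hΦ : ContDiffAt ℝ 2 (fun y ↦ a * (f₁ ∘ (extChartAt I z).symm) y + c * (f₂ ∘ (extChartAt I z).symm) y)
      (extChartAt I z z) := (contDiffAt_const.mul hΦ₁).add (contDiffAt_const.mul hΦ₂)
  have hf : CMDiffAt 2 (fun y ↦ a * f₁ y + c * f₂ y) z :=
    (contMDiffAt_const.mul hf₁).add (contMDiffAt_const.mul hf₂)
  -- every `C²` function transported to the chart
  have key : ∀ {f : M → ℝ}, CMDiffAt 2 f z → ContDiffAt ℝ 2 (f ∘ (extChartAt I z).symm) (extChartAt I z z) →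
      g.laplaceBeltrami f z = lapAt (chartRep I (fun _ ↦ g) z 0) (f ∘ (extChartAt I z).symm) u₀ := by
    intro f hfz hΦc
    rw [← hzu] at hfz
    have hc := g.dalembertian_comap contMDiff_pullbackBilin_holds (contMDiff_chartInv z)
      (injective_mfderiv_chartInv z) rfl hfz
    rw [hzu] at hc
    rw [laplaceBeltrami_eq_dalembertian, ← hc]
    exact Lorentzian.OpensChart.dalembertian_eq_lapAt hG u₀ (fun _ ↦ rfl) hΦc
  rw [key hf hΦ, key hf₁ hΦ₁, key hf₂ hΦ₂]
  change lapAt _ (fun y ↦ a * (f₁ ∘ (extChartAt I z).symm) y + c * (f₂ ∘ (extChartAt I z).symm) y) _ = _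
  rw [lapAt_add _ (contDiffAt_const.mul hΦ₁) (contDiffAt_const.mul hΦ₂),
    lapAt_const_mul _ hΦ₁, lapAt_const_mul _ hΦ₂]

end Linear

section Shi

variable {E : Type*} [NormedAddCommGroup E] [NormedSpace ℝ E] [FiniteDimensional ℝ E]
  [CompleteSpace E] {H : Type*} [TopologicalSpace H] {I : ModelWithCorners ℝ E H} [I.Boundaryless]
  {M : Type*} [TopologicalSpace M] [ChartedSpace H M] [IsManifold I ∞ M]
  {g : ℝ → PseudoRiemannianMetric I ∞ E (TangentSpace I : M → Type _)}
  {cov : ℝ → CovariantDerivative I E (TangentSpace I : M → Type _)} {T : ℝ}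

omit [FiniteDimensional ℝ E] [CompleteSpace E] in
/-- `∇^k Rm` of a time-translated family is the time translate. [folklore] -/
theorem curvD_comp_time {ι : Type*} [Fintype ι] (b : Basis ι ℝ E) (G : ℝ → E → E →L[ℝ] E →L[ℝ] ℝ)
    (φ : ℝ → ℝ) (k : ℕ) : ∀ t, curvD (fun r ↦ G (φ r)) b k t = curvD G b k (φ t) := by
  induction k with
  | zero => intro t; rfl
  | succ k ih => intro t; rw [curvD_succ, curvD_succ, ih t]

omit [CompleteSpace E] [I.Boundaryless] in
/-- **`U_k` of the time-translated family `r ↦ g (r + a)` is the time translate of `U_k`.**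
[folklore] -/
theorem curvDerivNormSq_comp_add_const (g : ℝ → PseudoRiemannianMetric I ∞ E (TangentSpace I : M → Type _))
    (a : ℝ) (k : ℕ) (r : ℝ) (z : M) :
    curvDerivNormSq I (fun s ↦ g (s + a)) k r z = curvDerivNormSq I g k (r + a) z := by
  unfold curvDerivNormSq
  have h : chartRep I (fun s ↦ g (s + a)) z = fun s ↦ chartRep I g z (s + a) := rfl
  rw [h, curvD_comp_time (finBasis ℝ E) (chartRep I g z) (· + a) k r]

/-- The time set `[0, T)`, `T > 0`, is admissible for the component calculus. [folklore] -/
theorem Ico_subset_closure_interior (hT : 0 < T) : Ico 0 T ⊆ closure (interior (Ico 0 T)) := by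
  rw [interior_Ico, closure_Ioo hT.ne]
  exact Ico_subset_Icc_self

variable [CompactSpace M]

local notation "U" => curvDerivNormSq I g

/-- **The Bernstein step of Topping 2006, Thm. 3.3.1** (p. 38, for every `k`): along a Ricci flow
of Riemannian metrics on `[0, T)`, `T > 0`, on a closed manifold, if `U_0, …, U_k ≤ B` on
`M × [0, T)` then `t · U_{k+1}(t, ·)` is bounded on `M × [0, T)`: with the evolution inequalities
(3.3.4) for `U_{k+1}` and `U_k` (`IsRicciFlow.derivWithin_curvDerivNormSq_le`), the function
`W = t U_{k+1} + α U_k`, `α = ½(1 + T A)`, satisfies `∂_t W ≤ Δ W + F` with a constant `F`, and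
`W(·, 0) = α U_k ≤ α B`, so `W ≤ α B + F t` by the weak maximum principle (Thm. 3.1.1) on every
`[0, τ] ⊂ [0, T)`. [cite: Topping2006, Thm. 3.3.1 (proof, p. 38)] -/
theorem IsRicciFlow.mul_curvDerivNormSq_succ_le (hflow : IsRicciFlow g cov (Ico 0 T)) (hT : 0 < T)
    (hR : ∀ s ∈ Ico 0 T, (g s).IsRiemannian) (k : ℕ) {B : ℝ} (hB0 : 0 ≤ B)
    (hB : ∀ j ≤ k, ∀ s ∈ Ico 0 T, ∀ z : M, curvDerivNormSq I g j s z ≤ B) :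
    ∃ W₀ : ℝ, ∀ s ∈ Ico 0 T, ∀ z : M, s * curvDerivNormSq I g (k + 1) s z ≤ W₀ := by
  have hS : UniqueDiffOn ℝ (Ico 0 T) := uniqueDiffOn_Ico 0 T
  have hS' := Ico_subset_closure_interior hT
  have h0 : (0 : ℝ) ∈ Ico 0 T := ⟨le_rfl, hT⟩
  obtain ⟨C₁, hC₁0, hP₁⟩ := hflow.derivWithin_curvDerivNormSq_le hS hS' hR h0 (k + 1)
  obtain ⟨C₂, hC₂0, hP₂⟩ := hflow.derivWithin_curvDerivNormSq_le hS hS' hR h0 k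
  have hUnn : ∀ j, ∀ s ∈ Ico 0 T, ∀ z, 0 ≤ U j s z := fun j s hs z ↦ curvDerivNormSq_nonneg (hR s hs) j z
  -- the constants
  set rB := Real.sqrt B with hrB
  have hrB0 : 0 ≤ rB := Real.sqrt_nonneg _
  set A₁ : ℝ := C₁ * (3 * rB + 1 / 2) with hA₁
  have hA₁0 : 0 ≤ A₁ := by positivity
  set D₁ : ℝ := C₁ * ((k : ℝ) * B) ^ 2 / 2 with hD₁
  have hD₁0 : 0 ≤ D₁ := by positivity
  set D₂ : ℝ := C₂ * (((k : ℝ) + 1) * B) * rB + C₂ * rB * B with hD₂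
  have hD₂0 : 0 ≤ D₂ := by positivity
  set α : ℝ := (1 + T * A₁) / 2 with hα
  have hα0 : 0 ≤ α := by positivity
  set Fc : ℝ := T * D₁ + α * D₂ with hFc
  have hFc0 : 0 ≤ Fc := by positivity
  refine ⟨α * B + Fc * T, fun s hs z ↦ ?_⟩
  rcases eq_or_lt_of_le hs.1 with h0s | h0s
  · rw [← h0s, zero_mul]
    exact add_nonneg (mul_nonneg hα0 hB0) (mul_nonneg hFc0 hT.le)
  -- `0 < s < T`: the weak maximum principle on `[0, s]`
  have hsub : Icc 0 s ⊆ Ico 0 T := fun r hr ↦ ⟨hr.1, hr.2.trans_lt hs.2⟩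
  have hflow' : IsRicciFlow g cov (Icc 0 s) := hflow.mono hsub
  have hR' : ∀ r ∈ Icc 0 s, (g r).IsRiemannian := fun r hr ↦ hR r (hsub hr)
  have hSs : UniqueDiffOn ℝ (Icc 0 s) := uniqueDiffOn_Icc h0s
  have hSs' : Icc 0 s ⊆ closure (interior (Icc 0 s)) := by rw [interior_Icc, closure_Ioo h0s.ne]
  set W : ℝ → M → ℝ := fun r x ↦ r * U (k + 1) r x + α * U k r x with hW
  -- smoothness of `W`
  have husmooth : ContMDiffOn (I.prod 𝓘(ℝ, ℝ)) 𝓘(ℝ, ℝ) ∞ (fun p : M × ℝ ↦ W p.2 p.1) (univ ×ˢ Icc 0 s) := by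
    have h1 := hflow'.contMDiffOn_curvDerivNormSq hSs hSs' hR' (k + 1)
    have h2 := hflow'.contMDiffOn_curvDerivNormSq hSs hSs' hR' k
    have h3 : ContMDiffOn (I.prod 𝓘(ℝ, ℝ)) 𝓘(ℝ, ℝ) ∞ (fun p : M × ℝ ↦ p.2) (univ ×ˢ Icc 0 s) :=
      contMDiffOn_snd
    have h4 : ContMDiffOn (I.prod 𝓘(ℝ, ℝ)) 𝓘(ℝ, ℝ) ∞ (fun _ : M × ℝ ↦ α) (univ ×ˢ Icc 0 s) :=
      contMDiffOn_const
    have heq : (fun p : M × ℝ ↦ W p.2 p.1) =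
        (fun p : M × ℝ ↦ p.2) * (fun p : M × ℝ ↦ U (k + 1) p.2 p.1)
          + (fun _ : M × ℝ ↦ α) * (fun p : M × ℝ ↦ U k p.2 p.1) := by
      funext p; rfl
    rw [heq]
    exact (h3.mul h1).add (h4.mul h2)
  -- the differential inequality for `W`
  have hineq : ∀ r ∈ Icc 0 s, ∀ x : M, derivWithin (fun r' ↦ W r' x) (Icc 0 s) r ≤
      (g r).laplaceBeltrami (W r) x + mvfderiv I (W r) x ((fun (_ : ℝ) (_ : M) ↦ (0 : E)) r x)
        + (fun (_ _ : ℝ) ↦ Fc) (W r x) r := by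
    intro r hr x
    have hrT : r ∈ Ico 0 T := hsub hr
    have hrle : r ≤ T := hrT.2.le
    -- time derivatives within `[0, T)` and within `[0, s]`
    have hd₁ := hflow.hasDerivWithinAt_curvDerivNormSq hS hS' hR (k + 1) x hrT
    have hd₂ := hflow.hasDerivWithinAt_curvDerivNormSq hS hS' hR k x hrT
    set d₁ := derivWithin (fun r' ↦ curvDerivNormSq I g (k + 1) r' x) (Ico 0 T) r with hd₁def
    set d₂ := derivWithin (fun r' ↦ curvDerivNormSq I g k r' x) (Ico 0 T) r with hd₂def
    have hdW : HasDerivWithinAt (fun r' ↦ W r' x) (1 * U (k + 1) r x + r * d₁ + α * d₂) (Ico 0 T) r :=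
      ((hasDerivWithinAt_id r _).mul hd₁).add (hd₂.const_mul α)
    rw [(hdW.mono hsub).derivWithin (hSs r hr), one_mul]
    have hmv : mvfderiv I (W r) x ((fun (_ : ℝ) (_ : M) ↦ (0 : E)) r x) = 0 := map_zero _
    rw [hmv, add_zero]
    -- the Laplacian of `W r`
    have h2 : (2 : ℕ∞ω) ≤ ∞ := WithTop.coe_le_coe.mpr le_top
    have hsm : ∀ j, CMDiffAt 2 (curvDerivNormSq I g j r) x := fun j ↦
      (contMDiffAt_curvDerivNormSq (hR r hrT) j x).of_le h2
    have hlap : (g r).laplaceBeltrami (W r) x =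
        r * (g r).laplaceBeltrami (U (k + 1) r) x + α * (g r).laplaceBeltrami (U k r) x :=
      laplaceBeltrami_add_mul (g r) (hsm (k + 1)) (hsm k) r α
    rw [hlap]
    -- the evolution inequalities
    have hq₁ := hP₁ r hrT x
    have hq₂ := hP₂ r hrT x
    rw [← hd₁def] at hq₁
    rw [← hd₂def] at hq₂
    -- abbreviations
    have hu := hUnn (k + 1) r hrT x
    have hu2 := hUnn (k + 1 + 1) r hrT x
    have huk := hUnn k r hrT x
    set u := U (k + 1) r x with hudef
    set v := Real.sqrt u with hvdef
    have hv0 : 0 ≤ v := Real.sqrt_nonneg _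
    have hvv : v * v = u := Real.mul_self_sqrt hu
    have hsq : ∀ j ≤ k, Real.sqrt (U j r x) ≤ rB := fun j hj ↦ Real.sqrt_le_sqrt (hB j hj r hrT x)
    have hsq0 : ∀ j, 0 ≤ Real.sqrt (U j r x) := fun j ↦ Real.sqrt_nonneg _
    -- the sum in the `U_{k+1}` inequality: `Σ_{p ≤ k+1} √U_p √U_{k+1-p} ≤ 2 rB v + k B`
    have hsum₁ : ∑ p ∈ Finset.range (k + 1 + 1), Real.sqrt (U p r x) * Real.sqrt (U (k + 1 - p) r x)
        ≤ 2 * rB * v + k * B := by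
      rw [Finset.sum_range_succ, Finset.sum_range_succ', Nat.sub_self, Nat.sub_zero]
      have hmid : ∑ p ∈ Finset.range k, Real.sqrt (U (p + 1) r x) * Real.sqrt (U (k + 1 - (p + 1)) r x)
          ≤ k * B := by
        have h : ∀ p ∈ Finset.range k, Real.sqrt (U (p + 1) r x) * Real.sqrt (U (k + 1 - (p + 1)) r x) ≤ B := by
          intro p hp
          have hp' : p < k := Finset.mem_range.mp hp
          have h1 : Real.sqrt (U (p + 1) r x) ≤ rB := hsq (p + 1) (by omega)
          have h2 : Real.sqrt (U (k + 1 - (p + 1)) r x) ≤ rB := hsq _ (by omega)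
          calc _ ≤ rB * rB := mul_le_mul h1 h2 (hsq0 _) hrB0
            _ = B := Real.mul_self_sqrt hB0
        calc _ ≤ ∑ p ∈ Finset.range k, B := Finset.sum_le_sum h
          _ = k * B := by rw [Finset.sum_const, Finset.card_range, nsmul_eq_mul]
      have hfirst : Real.sqrt (U 0 r x) * Real.sqrt (U (k + 1) r x) ≤ rB * v :=
        mul_le_mul (hsq 0 (Nat.zero_le _)) le_rfl (hsq0 _) hrB0
      have hlast : Real.sqrt (U (k + 1) r x) * Real.sqrt (U 0 r x) ≤ v * rB :=
        mul_le_mul le_rfl (hsq 0 (Nat.zero_le _)) (hsq0 _) hv0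
      linarith only [hmid, hfirst, hlast]
    -- the sum in the `U_k` inequality: `Σ_{p ≤ k} √U_p √U_{k-p} ≤ (k+1) B`
    have hsum₂ : ∑ p ∈ Finset.range (k + 1), Real.sqrt (U p r x) * Real.sqrt (U (k - p) r x)
        ≤ ((k : ℝ) + 1) * B := by
      have h : ∀ p ∈ Finset.range (k + 1), Real.sqrt (U p r x) * Real.sqrt (U (k - p) r x) ≤ B := by
        intro p hp
        have hp' : p < k + 1 := Finset.mem_range.mp hp
        calc _ ≤ rB * rB := mul_le_mul (hsq p (by omega)) (hsq _ (by omega)) (hsq0 _) hrB0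
          _ = B := Real.mul_self_sqrt hB0
      calc _ ≤ ∑ p ∈ Finset.range (k + 1), B := Finset.sum_le_sum h
        _ = ((k : ℝ) + 1) * B := by
          rw [Finset.sum_const, Finset.card_range, nsmul_eq_mul]; push_cast; ring
    -- bound for `d₁`
    have hS₁nn : 0 ≤ ∑ p ∈ Finset.range (k + 1 + 1), Real.sqrt (U p r x) * Real.sqrt (U (k + 1 - p) r x) :=
      Finset.sum_nonneg fun p _ ↦ mul_nonneg (hsq0 _) (hsq0 _)
    have hb₁ : d₁ ≤ (g r).laplaceBeltrami (U (k + 1) r) x + A₁ * u + D₁ := by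
      have e1 : C₁ * (∑ p ∈ Finset.range (k + 1 + 1), Real.sqrt (U p r x) * Real.sqrt (U (k + 1 - p) r x))
          * v ≤ C₁ * (2 * rB * v + k * B) * v :=
        mul_le_mul_of_nonneg_right (mul_le_mul_of_nonneg_left hsum₁ hC₁0) hv0
      have e2 : C₁ * Real.sqrt (U 0 r x) * u ≤ C₁ * rB * u :=
        mul_le_mul_of_nonneg_right (mul_le_mul_of_nonneg_left (hsq 0 (Nat.zero_le _)) hC₁0) hu
      have e3 : (k : ℝ) * B * v ≤ (((k : ℝ) * B) ^ 2 + u) / 2 := by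
        nlinarith [sq_nonneg ((k : ℝ) * B - v), hvv]
      have e4 : C₁ * (2 * rB * v + k * B) * v ≤ C₁ * (2 * rB) * u + C₁ * ((((k : ℝ) * B) ^ 2 + u) / 2) := by
        have : C₁ * (2 * rB * v + k * B) * v = C₁ * (2 * rB) * (v * v) + C₁ * ((k : ℝ) * B * v) := by ring
        rw [this, hvv]
        exact add_le_add le_rfl (mul_le_mul_of_nonneg_left e3 hC₁0)
      have hdrop : -2 * U (k + 1 + 1) r x ≤ 0 := by linarith
      have : C₁ * (2 * rB) * u + C₁ * ((((k : ℝ) * B) ^ 2 + u) / 2) + C₁ * rB * u = A₁ * u + D₁ := by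
        rw [hA₁, hD₁]; ring
      linarith only [hq₁, e1, e4, e2, hdrop, this]
    -- bound for `d₂`
    have hb₂ : d₂ ≤ (g r).laplaceBeltrami (U k r) x - 2 * u + D₂ := by
      have e1 : C₂ * (∑ p ∈ Finset.range (k + 1), Real.sqrt (U p r x) * Real.sqrt (U (k - p) r x))
          * Real.sqrt (U k r x) ≤ C₂ * (((k : ℝ) + 1) * B) * rB :=
        mul_le_mul (mul_le_mul_of_nonneg_left hsum₂ hC₂0) (hsq k le_rfl) (hsq0 _) (by positivity)
      have e2 : C₂ * Real.sqrt (U 0 r x) * U k r x ≤ C₂ * rB * B :=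
        mul_le_mul (mul_le_mul_of_nonneg_left (hsq 0 (Nat.zero_le _)) hC₂0) (hB k le_rfl r hrT x) huk
          (by positivity)
      have : C₂ * (((k : ℝ) + 1) * B) * rB + C₂ * rB * B = D₂ := by rw [hD₂]
      linarith only [hq₂, e1, e2, this]
    -- combine
    have hr0 : 0 ≤ r := hr.1
    have hcoef : u * (1 + r * A₁ - 2 * α) ≤ 0 := by
      have : 1 + r * A₁ - 2 * α = (r - T) * A₁ := by rw [hα]; ring
      rw [this]
      exact mul_nonpos_of_nonneg_of_nonpos hu (mul_nonpos_of_nonpos_of_nonneg (by linarith) hA₁0)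
    have hrD : r * D₁ ≤ T * D₁ := mul_le_mul_of_nonneg_right hrle hD₁0
    generalize (g r).laplaceBeltrami (U (k + 1) r) x = L₁ at hb₁ ⊢
    generalize (g r).laplaceBeltrami (U k r) x = L₂ at hb₂ ⊢
    have step1 : r * d₁ ≤ r * (L₁ + A₁ * u + D₁) := mul_le_mul_of_nonneg_left hb₁ hr0
    have step2 : α * d₂ ≤ α * (L₂ - 2 * u + D₂) := mul_le_mul_of_nonneg_left hb₂ hα0
    show u + r * d₁ + α * d₂ ≤ r * L₁ + α * L₂ + Fc
    calc u + r * d₁ + α * d₂ ≤ u + r * (L₁ + A₁ * u + D₁) + α * (L₂ - 2 * u + D₂) := by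
          linarith only [step1, step2]
      _ = r * L₁ + α * L₂ + (u * (1 + r * A₁ - 2 * α) + r * D₁ + α * D₂) := by ring
      _ ≤ r * L₁ + α * L₂ + (0 + T * D₁ + α * D₂) := by linarith only [hcoef, hrD]
      _ = r * L₁ + α * L₂ + Fc := by rw [hFc]; ring
  -- the comparison function
  have hF' : ContDiffOn ℝ 1 (uncurry fun (_ _ : ℝ) ↦ Fc) (univ ×ˢ Icc 0 s) := contDiffOn_const
  have hφd : ∀ r ∈ Icc 0 s, HasDerivWithinAt (fun r' ↦ α * B + Fc * r') ((fun (_ _ : ℝ) ↦ Fc) (α * B + Fc * r) r)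
      (Icc 0 s) r := by
    intro r _
    have h := ((hasDerivAt_id r).const_mul Fc).const_add (α * B)
    simp only [mul_one] at h
    exact h.hasDerivWithinAt
  have hφ0 : (fun r' ↦ α * B + Fc * r') 0 = α * B := by simp
  have hu0 : ∀ x : M, W 0 x ≤ α * B := by
    intro x
    show 0 * U (k + 1) 0 x + α * U k 0 x ≤ α * B
    rw [zero_mul, zero_add]
    exact mul_le_mul_of_nonneg_left (hB k le_rfl 0 h0 x) hα0
  have hmp := weakMaximumPrinciple h0s hR' (fun (_ : ℝ) (_ : M) ↦ (0 : E)) hF' husmooth hineq hφd hφ0 hu0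
    s ⟨h0s.le, le_rfl⟩ z
  -- conclusion
  have hWs : s * U (k + 1) s z ≤ W s z :=
    le_add_of_nonneg_right (mul_nonneg hα0 (hUnn k s hs z))
  have hφs : α * B + Fc * s ≤ α * B + Fc * T :=
    add_le_add le_rfl (mul_le_mul_of_nonneg_left hs.2.le hFc0)
  exact hWs.trans (hmp.trans hφs)

/-- **Topping 2006, Thm. 3.3.1 / Cor. 3.3.2 (`j = 0`), qualitative form (Shi–Bernstein global
derivative estimates; Hamilton 1982, §13).** Along a Ricci flow of Riemannian metrics on `[0, T)`,
`T > 0`, on a closed manifold, with curvature bounded in frames by `K` at all times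
(`CurvatureBoundedBy`), for every `k` and every `δ ∈ (0, T)` the functions
`U_0, …, U_k = |∇^j Rm|²` are bounded on `M × [δ, T)` ("if `|Rm| ≤ M` throughout then
`|∇^k Rm| ≤ C M / t^{k/2}`"; here only boundedness away from `t = 0` is asserted, which is what
the proof of Thm. 5.3.1 uses). Proof: induction on `k`; `U_0 = |Rm|² ≤ n⁴K²`
(`curvNormSqWith_le_of_curvatureBoundedBy`); the step is `mul_curvDerivNormSq_succ_le` applied to
the flow translated by `δ/2`. [cite: Topping2006, Thm. 3.3.1] [cite: Topping2006, Cor. 3.3.2]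
[cite: Hamilton1982, §13] -/
theorem IsRicciFlow.curvDerivNormSq_le_of_curvatureBoundedBy (hflow : IsRicciFlow g cov (Ico 0 T))
    (hT : 0 < T) (hR : ∀ s ∈ Ico 0 T, (g s).IsRiemannian) {K : ℝ}
    (hbd : ∀ s ∈ Ico 0 T, CurvatureBoundedBy (g s) (cov s) K) (k : ℕ) :
    ∀ δ : ℝ, 0 < δ → δ < T → ∃ B : ℝ, 0 ≤ B ∧
      ∀ j ≤ k, ∀ s ∈ Ico δ T, ∀ z : M, curvDerivNormSq I g j s z ≤ B := by
  induction k with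
  | zero =>
    intro δ hδ hδT
    refine ⟨(finrank ℝ E : ℝ) ^ 4 * K ^ 2, by positivity, fun j hj s hs z ↦ ?_⟩
    obtain rfl : j = 0 := Nat.le_zero.mp hj
    have hsT : s ∈ Ico 0 T := ⟨hδ.le.trans hs.1, hs.2⟩
    rw [curvDerivNormSq_zero_eq (hR s hsT) (hflow.isLeviCivita s hsT)]
    exact curvNormSqWith_le_of_curvatureBoundedBy (hR s hsT) (hflow.isLeviCivita s hsT) (hbd s hsT) z
  | succ k ih =>
    intro δ hδ hδT
    obtain ⟨B, hB0, hB⟩ := ih (δ / 2) (by positivity) (by linarith)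
    -- the translated flow on `[0, T - δ/2)`
    set a : ℝ := δ / 2 with ha
    have ha0 : 0 < a := by positivity
    have hsubI : Ico a T ⊆ Ico 0 T := fun r hr ↦ ⟨ha0.le.trans hr.1, hr.2⟩
    have hflow' : IsRicciFlow (fun r ↦ g (r + a)) (fun r ↦ cov (r + a)) (Ico 0 (T - a)) := by
      have h := (hflow.mono hsubI).comp_add_const a
      rwa [Set.preimage_add_const_Ico, sub_self] at h
    have hT' : 0 < T - a := by rw [ha]; linarith
    have hmem : ∀ r ∈ Ico 0 (T - a), r + a ∈ Ico a T := fun r hr ↦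
      ⟨by linarith [hr.1], by linarith [hr.2]⟩
    have hR'' : ∀ r ∈ Ico 0 (T - a), (g (r + a)).IsRiemannian := fun r hr ↦ hR _ (hsubI (hmem r hr))
    have hB' : ∀ j ≤ k, ∀ r ∈ Ico 0 (T - a), ∀ z : M,
        curvDerivNormSq I (fun s ↦ g (s + a)) j r z ≤ B := by
      intro j hj r hr z
      rw [curvDerivNormSq_comp_add_const]
      exact hB j hj (r + a) (hmem r hr) z
    obtain ⟨W₀, hW₀⟩ := hflow'.mul_curvDerivNormSq_succ_le hT' hR'' k hB0 hB'
    refine ⟨max B (W₀ / a), le_max_of_le_left hB0, fun j hj s hs z ↦ ?_⟩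
    rcases Nat.of_le_succ hj with hjk | rfl
    · exact (hB j hjk s ⟨by linarith [hs.1], hs.2⟩ z).trans (le_max_left _ _)
    · -- `j = k + 1`
      have hr : s - a ∈ Ico 0 (T - a) := ⟨by rw [ha]; linarith [hs.1], by linarith [hs.2]⟩
      have h := hW₀ (s - a) hr z
      rw [curvDerivNormSq_comp_add_const, sub_add_cancel] at h
      have hsa : a ≤ s - a := by rw [ha]; linarith [hs.1]
      have hUnn : 0 ≤ curvDerivNormSq I g (k + 1) s z :=
        curvDerivNormSq_nonneg (hR s ⟨hδ.le.trans hs.1, hs.2⟩) _ z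
      refine le_trans ?_ (le_max_right _ _)
      rw [le_div_iff₀ ha0]
      calc curvDerivNormSq I g (k + 1) s z * a ≤ curvDerivNormSq I g (k + 1) s z * (s - a) :=
            mul_le_mul_of_nonneg_left hsa hUnn
        _ = (s - a) * curvDerivNormSq I g (k + 1) s z := mul_comm _ _
        _ ≤ W₀ := h

end Shi

end Literature.Geometry.Riemannian

end
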